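import Literature.Computability.Complexity.Hastad3SatTest
import Mathlib.Analysis.Complex.Exponential
import HarnessLib

/-!
# Håstad's 3-SAT test `3S^ε`: the pointwise estimates (eqs. (39), (40), (44)–(45), Lemma 6.8)

Håstad, *Some optimal inapproximability results*, J. ACM 48 (2001), §6.1, the elementary estimates of
the factors `c^±_ε(s) = ((-1)^s ± (1 - 2ε)^s)/2` (`cFac`) and of the products
`p(α, β) = ∏_{x ∈ π(β)} c^{[x ∈ α]}(s_x)` (`termProd`) that enter the acceptance probability of Test
`3S^ε` (`Hastad3SatTest.lean`, eq. (34)), everything PROVED, for `0 ≤ ε ≤ 1/2`: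

* `|c^±(s)| ≤ 1`, and `|c⁺(s)| + |c⁻(s)| = 1` (the "`a² + b²` with `|a| + |b| = 1`" of eq. (45));
* **eq. (39)** in the form `|c^±(s)| ≤ Real.exp(-min(1, sε)/4)` (`abs_cFac_le_exp`).  Håstad prints the
  exponent `min(1, sε)/2`; the constant `1/4` is what the elementary bound `1 + x ≤ eˣ` gives without
  numerical constants, and every later use only needs SOME absolute constant here (the thresholds of
  Lemma 6.7 / Cor. 6.10 are chosen accordingly downstream);
* Håstad's `S^U_ε(β) = ε ∑_x min(s_x, ε⁻¹) = ∑_{x ∈ π(β)} min(1, ε s_x)` (`SU`) and **eq. (40)**: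
  `|p(α, β)| ≤ Real.exp(-S^U_ε(β)/4)` (`abs_termProd_le_exp`);
* **eqs. (44)–(45)**: `∑_{α ⊆ π(β)} p(α, β)² = ∏_{x ∈ π(β)} (c⁻(s_x)² + c⁺(s_x)²) ≤ Real.exp(-S^U_ε(β)/4)`
  (`sum_termProd_sq_eq_prod`, `sum_termProd_sq_le_exp`);
* **Lemma 6.8** (pointwise part): for odd `s`, `-sε ≤ c⁺(s) ≤ 0`; hence for `|β|` odd (the only `β`
  carrying Fourier weight of a folded table) some fibre `s_x` is odd and
  `|p(∅, β)| ≤ |β| ε` (`abs_termProd_empty_le_card_mul`), and the weighted sum over the `β` with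
  `|β| ≤ δ ε⁻¹` is at most `δ` (`abs_sum_small_le`);
* the injective case used with smooth projections: if `π` is injective on `β` then every `s_x = 1`
  and `p(∅, β) = (-ε)^{|β|}` (`termProd_empty_of_injOn`).

## References

* J. Håstad, *Some optimal inapproximability results*, J. ACM 48 (2001) 798–859, §6.1: eqs. (39),
  (40), (44), (45), Lemma 6.8 [Hastad2001].
-/

noncomputable section

namespace Literature.Computability.Complexity.Hastad3Sat

open Finset Literature.Probability.RandomGraphs.LowDegree Literature.Computability.Complexity.LongCode

variable {ι κ : Type*} [Fintype ι] [DecidableEq ι] [Fintype κ] [DecidableEq κ]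

/-! ### The factors `c^±(s)` -/

omit [Fintype ι] [DecidableEq ι] [Fintype κ] [DecidableEq κ] in
/-- `0 ≤ (1 - 2ε)^s ≤ 1` for `0 ≤ ε ≤ 1/2`. [cite: Hastad2001, §6.1 (eq. (39))] -/
theorem pow_one_sub_two_mul_mem {ε : ℝ} (hε : 0 ≤ ε) (hε' : ε ≤ 1 / 2) (s : ℕ) :
    0 ≤ (1 - 2 * ε) ^ s ∧ (1 - 2 * ε) ^ s ≤ 1 :=
  ⟨pow_nonneg (by linarith) s, pow_le_one₀ (by linarith) (by linarith)⟩

omit [Fintype ι] [DecidableEq ι] [Fintype κ] [DecidableEq κ] in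
/-- `|c^±(s)| ≤ (1 + (1 - 2ε)^s)/2`. [cite: Hastad2001, §6.1 (eq. (39))] -/
theorem abs_cFac_le_half {ε : ℝ} (hε : 0 ≤ ε) (hε' : ε ≤ 1 / 2) (neg : Bool) (s : ℕ) :
    |cFac ε neg s| ≤ (1 + (1 - 2 * ε) ^ s) / 2 := by
  obtain ⟨h0, _⟩ := pow_one_sub_two_mul_mem hε hε' s
  unfold cFac
  rw [abs_div, abs_two, div_le_div_iff_of_pos_right two_pos]
  calc |(-1) ^ s + (if neg then -1 else 1) * (1 - 2 * ε) ^ s|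
      ≤ |((-1 : ℝ)) ^ s| + |(if neg then -1 else (1 : ℝ)) * (1 - 2 * ε) ^ s| := abs_add_le _ _
    _ = 1 + (1 - 2 * ε) ^ s := by
        rw [abs_pow, abs_neg, abs_one, one_pow, abs_mul, abs_of_nonneg h0]
        cases neg <;> simp

omit [Fintype ι] [DecidableEq ι] [Fintype κ] [DecidableEq κ] in
/-- `|c^±(s)| ≤ 1`. [cite: Hastad2001, §6.1] -/
theorem abs_cFac_le_one {ε : ℝ} (hε : 0 ≤ ε) (hε' : ε ≤ 1 / 2) (neg : Bool) (s : ℕ) :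
    |cFac ε neg s| ≤ 1 := by
  have h := abs_cFac_le_half hε hε' neg s
  have h1 := (pow_one_sub_two_mul_mem hε hε' s).2
  linarith

omit [Fintype ι] [DecidableEq ι] [Fintype κ] [DecidableEq κ] in
/-- `|c⁻(s)| + |c⁺(s)| = 1` (eq. (45): "the factor … is of the form `a² + b²` where `|a| + |b| = 1`").
[cite: Hastad2001, §6.1 (eq. (45))] -/
theorem abs_cFac_add_abs_cFac {ε : ℝ} (hε : 0 ≤ ε) (hε' : ε ≤ 1 / 2) (s : ℕ) :
    |cFac ε true s| + |cFac ε false s| = 1 := by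
  obtain ⟨h0, h1⟩ := pow_one_sub_two_mul_mem hε hε' s
  unfold cFac
  rcases Nat.even_or_odd s with hs | hs
  · rw [hs.neg_one_pow]
    simp only [if_true, if_false, Bool.false_eq_true]
    rw [abs_of_nonneg (by linarith), abs_of_nonneg (by linarith)]
    ring
  · rw [hs.neg_one_pow]
    simp only [if_true, if_false, Bool.false_eq_true]
    rw [abs_of_nonpos (by linarith), abs_of_nonpos (by linarith)]
    ring

omit [Fintype ι] [DecidableEq ι] [Fintype κ] [DecidableEq κ] in
/-- The analytic inequality behind eq. (39), with constant `1/4`: for `x ≥ 0`,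
`(1 + e^{-2x})/2 ≤ e^{-min(1,x)/4}`.  For `x ≤ 1`, with `τ = e^{-x/4} ∈ [3/4, 1]` this is
`τ⁸ - 2τ + 1 = (τ - 1)(τ⁷ + ⋯ + τ - 1) ≤ 0`; for `x ≥ 1`, `(1 + e^{-2})/2 ≤ 2/3 ≤ 3/4 ≤ e^{-1/4}`.
[cite: Hastad2001, §6.1 (eq. (39))] -/
theorem half_one_add_exp_le {x : ℝ} (hx : 0 ≤ x) :
    (1 + Real.exp (-(2 * x))) / 2 ≤ Real.exp (-(min 1 x) / 4) := by
  have h34 : (3 : ℝ) / 4 ≤ Real.exp (-(1 : ℝ) / 4) := by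
    have := Real.add_one_le_exp (-(1 : ℝ) / 4); linarith
  rcases le_total x 1 with hx1 | hx1
  · rw [min_eq_right hx1]
    set τ := Real.exp (-x / 4) with hτ
    have hτ1 : τ ≤ 1 := by rw [hτ]; exact Real.exp_le_one_iff.2 (by linarith)
    have hτ34 : 3 / 4 ≤ τ := h34.trans (Real.exp_le_exp.2 (by linarith))
    have h8 : Real.exp (-(2 * x)) = τ ^ 8 := by
      rw [hτ, ← Real.exp_nat_mul]; congr 1; push_cast; ring
    rw [h8]
    have hp : 0 ≤ τ ^ 7 + τ ^ 6 + τ ^ 5 + τ ^ 4 + τ ^ 3 + τ ^ 2 + τ - 1 := by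
      nlinarith [pow_nonneg (by linarith : (0 : ℝ) ≤ τ) 7, pow_nonneg (by linarith : (0 : ℝ) ≤ τ) 6,
        pow_nonneg (by linarith : (0 : ℝ) ≤ τ) 5, pow_nonneg (by linarith : (0 : ℝ) ≤ τ) 4,
        pow_nonneg (by linarith : (0 : ℝ) ≤ τ) 3]
    have hfac : τ ^ 8 - 2 * τ + 1 = (τ - 1) * (τ ^ 7 + τ ^ 6 + τ ^ 5 + τ ^ 4 + τ ^ 3 + τ ^ 2 + τ - 1) := by
      ring
    have hle : τ ^ 8 - 2 * τ + 1 ≤ 0 := by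
      rw [hfac]; exact mul_nonpos_of_nonpos_of_nonneg (by linarith) hp
    linarith
  · rw [min_eq_left hx1]
    have h2 : Real.exp (-(2 * x)) ≤ 1 / 3 := by
      have h3 : (3 : ℝ) ≤ Real.exp 2 := by have := Real.add_one_le_exp (2 : ℝ); linarith
      rw [Real.exp_neg, ← one_div]
      calc 1 / Real.exp (2 * x) ≤ 1 / Real.exp 2 :=
            one_div_le_one_div_of_le (Real.exp_pos 2) (Real.exp_le_exp.2 (by linarith))
        _ ≤ 1 / 3 := one_div_le_one_div_of_le (by norm_num) h3
    linarith

omit [Fintype ι] [DecidableEq ι] [Fintype κ] [DecidableEq κ] in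
/-- **Håstad 2001, eq. (39)** (constant `1/4`): `|c^±_ε(s)| ≤ Real.exp(-min(1, sε)/4)` for `0 ≤ ε ≤ 1/2`.
[cite: Hastad2001, eq. (39)] -/
theorem abs_cFac_le_exp {ε : ℝ} (hε : 0 ≤ ε) (hε' : ε ≤ 1 / 2) (neg : Bool) (s : ℕ) :
    |cFac ε neg s| ≤ Real.exp (-(min 1 (s * ε)) / 4) := by
  have hpow : (1 - 2 * ε) ^ s ≤ Real.exp (-(2 * (s * ε))) := by
    calc (1 - 2 * ε) ^ s ≤ Real.exp (-(2 * ε)) ^ s :=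
          pow_le_pow_left₀ (by linarith) (by have := Real.add_one_le_exp (-(2 * ε)); linarith) s
      _ = Real.exp (-(2 * (s * ε))) := by rw [← Real.exp_nat_mul]; congr 1; ring
  calc |cFac ε neg s| ≤ (1 + (1 - 2 * ε) ^ s) / 2 := abs_cFac_le_half hε hε' neg s
    _ ≤ (1 + Real.exp (-(2 * (s * ε)))) / 2 := by linarith
    _ ≤ Real.exp (-(min 1 (s * ε)) / 4) := half_one_add_exp_le (by positivity)

/-! ### `S^U_ε(β)` and eq. (40) -/

omit [Fintype ι] [Fintype κ] [DecidableEq κ] in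
/-- Håstad's `S^U_ε(β) = ε ∑_x min(s_x, ε⁻¹) = ∑_{x ∈ π(β)} min(1, ε s_x)` ("a generalization of
`|π(β)|`"). [cite: Hastad2001, §6.1 (definition of S^U_ε before Lemma 6.9)] -/
def SU (ε : ℝ) (β : Finset κ) (π : κ → ι) : ℝ :=
  ∑ x ∈ β.image π, min 1 ((sFib β π x : ℝ) * ε)

omit [Fintype ι] [Fintype κ] [DecidableEq κ] in
/-- `S^U_ε(β) ≥ 0` for `ε ≥ 0`. [cite: Hastad2001, §6.1] -/
theorem SU_nonneg {ε : ℝ} (hε : 0 ≤ ε) (β : Finset κ) (π : κ → ι) : 0 ≤ SU ε β π :=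
  sum_nonneg fun x _ => le_min zero_le_one (by positivity)

omit [Fintype ι] [Fintype κ] [DecidableEq κ] in
/-- **Håstad 2001, eq. (40)** (for every `α`, constant `1/4`): `|p(α, β)| ≤ Real.exp(-S^U_ε(β)/4)`.
[cite: Hastad2001, eq. (40)] -/
theorem abs_termProd_le_exp {ε : ℝ} (hε : 0 ≤ ε) (hε' : ε ≤ 1 / 2) (π : κ → ι) (α : Finset ι)
    (β : Finset κ) : |termProd ε π α β| ≤ Real.exp (-(SU ε β π) / 4) := by
  unfold termProd SU
  have h : -(∑ x ∈ β.image π, min 1 ((sFib β π x : ℝ) * ε)) / 4 =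
      ∑ x ∈ β.image π, -(min 1 ((sFib β π x : ℝ) * ε)) / 4 := by
    rw [← Finset.sum_neg_distrib, Finset.sum_div]
  rw [Finset.abs_prod, h, Real.exp_sum]
  exact prod_le_prod (fun x _ => abs_nonneg _) fun x _ => abs_cFac_le_exp hε hε' _ _

omit [Fintype ι] [Fintype κ] [DecidableEq κ] in
/-- `|p(α, β)| ≤ 1`. [cite: Hastad2001, §6.1] -/
theorem abs_termProd_le_one {ε : ℝ} (hε : 0 ≤ ε) (hε' : ε ≤ 1 / 2) (π : κ → ι) (α : Finset ι)
    (β : Finset κ) : |termProd ε π α β| ≤ 1 := by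
  unfold termProd
  rw [Finset.abs_prod]
  exact prod_le_one (fun _ _ => abs_nonneg _) fun _ _ => abs_cFac_le_one hε hε' _ _

/-! ### Eqs. (44)–(45) -/

omit [Fintype ι] [Fintype κ] [DecidableEq κ] in
/-- **Eq. (45)**: `∑_{α ⊆ π(β)} p(α, β)² = ∏_{x ∈ π(β)} (c⁻(s_x)² + c⁺(s_x)²)`.
[cite: Hastad2001, eq. (45)] -/
theorem sum_termProd_sq_eq_prod (ε : ℝ) (π : κ → ι) (β : Finset κ) :
    ∑ α ∈ (β.image π).powerset, termProd ε π α β ^ 2 =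
      ∏ x ∈ β.image π, (cFac ε true (sFib β π x) ^ 2 + cFac ε false (sFib β π x) ^ 2) := by
  rw [prod_add]
  refine sum_congr rfl fun α hα => ?_
  rw [mem_powerset] at hα
  unfold termProd
  rw [← prod_pow, ← prod_sdiff hα, mul_comm]
  congr 1
  · exact prod_congr rfl fun x hx => by rw [decide_eq_true hx]
  · exact prod_congr rfl fun x hx => by rw [decide_eq_false (mem_sdiff.1 hx).2]

omit [Fintype ι] [DecidableEq ι] [Fintype κ] [DecidableEq κ] in
/-- `a² + b² ≤ max(|a|, |b|) (|a| + |b|)`. [folklore] -/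
theorem sq_add_sq_le_max_mul (a b : ℝ) : a ^ 2 + b ^ 2 ≤ max |a| |b| * (|a| + |b|) := by
  rw [mul_add, ← sq_abs a, ← sq_abs b, sq, sq]
  exact add_le_add (mul_le_mul_of_nonneg_right (le_max_left _ _) (abs_nonneg _))
    (mul_le_mul_of_nonneg_right (le_max_right _ _) (abs_nonneg _))

omit [Fintype ι] [Fintype κ] [DecidableEq κ] in
/-- **Eq. (44), last inequality** (constant `1/4`): `∑_{α ⊆ π(β)} p(α, β)² ≤ Real.exp(-S^U_ε(β)/4)`.
[cite: Hastad2001, eq. (44)] -/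
theorem sum_termProd_sq_le_exp {ε : ℝ} (hε : 0 ≤ ε) (hε' : ε ≤ 1 / 2) (π : κ → ι) (β : Finset κ) :
    ∑ α ∈ (β.image π).powerset, termProd ε π α β ^ 2 ≤ Real.exp (-(SU ε β π) / 4) := by
  rw [sum_termProd_sq_eq_prod]
  unfold SU
  have h : -(∑ x ∈ β.image π, min 1 ((sFib β π x : ℝ) * ε)) / 4 =
      ∑ x ∈ β.image π, -(min 1 ((sFib β π x : ℝ) * ε)) / 4 := by
    rw [← Finset.sum_neg_distrib, Finset.sum_div]
  rw [h, Real.exp_sum]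
  refine prod_le_prod (fun x _ => by positivity) fun x _ => ?_
  calc cFac ε true (sFib β π x) ^ 2 + cFac ε false (sFib β π x) ^ 2
      ≤ max |cFac ε true (sFib β π x)| |cFac ε false (sFib β π x)| *
          (|cFac ε true (sFib β π x)| + |cFac ε false (sFib β π x)|) := sq_add_sq_le_max_mul _ _
    _ = max |cFac ε true (sFib β π x)| |cFac ε false (sFib β π x)| := by
        rw [abs_cFac_add_abs_cFac hε hε', mul_one]
    _ ≤ Real.exp (-min 1 (↑(sFib β π x) * ε) / 4) :=
        max_le (abs_cFac_le_exp hε hε' _ _) (abs_cFac_le_exp hε hε' _ _)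

/-! ### Lemma 6.8: small sets -/

omit [Fintype ι] [DecidableEq ι] [Fintype κ] [DecidableEq κ] in
/-- For odd `s` and `0 ≤ ε ≤ 1/2`: `-sε ≤ c⁺(s) ≤ 0` ("`0 ≥ ½((-1)^s + (1-2ε)^s) ≥ ½(-1 + (1 - 2sε)) = -sε`").
[cite: Hastad2001, Lemma 6.8 (proof)] -/
theorem cFac_false_mem_of_odd {ε : ℝ} (hε : 0 ≤ ε) (hε' : ε ≤ 1 / 2) {s : ℕ} (hs : Odd s) :
    -(s * ε) ≤ cFac ε false s ∧ cFac ε false s ≤ 0 := by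
  obtain ⟨_, h1⟩ := pow_one_sub_two_mul_mem hε hε' s
  have hb : 1 + (s : ℝ) * (-(2 * ε)) ≤ (1 + -(2 * ε)) ^ s :=
    one_add_mul_le_pow (by linarith) s
  unfold cFac
  rw [hs.neg_one_pow]
  simp only [Bool.false_eq_true, if_false, one_mul]
  constructor
  · have : (1 + -(2 * ε)) ^ s = (1 - 2 * ε) ^ s := by ring
    rw [this] at hb
    linarith
  · linarith

omit [Fintype ι] [Fintype κ] [DecidableEq κ] in
/-- A set of odd size has a fibre of odd size: `∑_x s_x = |β|`. [cite: Hastad2001, Lemma 6.8 (proof)] -/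
theorem exists_odd_sFib {β : Finset κ} (π : κ → ι) (hodd : Odd β.card) :
    ∃ x ∈ β.image π, Odd (sFib β π x) := by
  by_contra h
  push Not at h
  have hev : Even (∑ x ∈ β.image π, sFib β π x) :=
    even_sum _ fun x hx => Nat.not_odd_iff_even.1 (h x hx)
  rw [sum_sFib] at hev
  exact (Nat.not_even_iff_odd.2 hodd) hev

omit [Fintype ι] [Fintype κ] [DecidableEq κ] in
/-- **Håstad 2001, Lemma 6.8** (pointwise): for `|β|` odd, `|p(∅, β)| ≤ |β| ε` — one fibre `s_x` is odd,
its factor lies in `[-s_x ε, 0]`, and all other factors are bounded by `1`. [cite: Hastad2001, Lemma 6.8] -/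
theorem abs_termProd_empty_le_card_mul {ε : ℝ} (hε : 0 ≤ ε) (hε' : ε ≤ 1 / 2) (π : κ → ι)
    {β : Finset κ} (hodd : Odd β.card) : |termProd ε π ∅ β| ≤ β.card * ε := by
  obtain ⟨x₀, hx₀, hsodd⟩ := exists_odd_sFib π hodd
  unfold termProd
  rw [← mul_prod_erase _ _ hx₀, abs_mul, Finset.abs_prod]
  simp only [notMem_empty, decide_false]
  have hs : (sFib β π x₀ : ℝ) ≤ β.card := by
    exact_mod_cast (single_le_sum (fun _ _ => Nat.zero_le _) hx₀).trans (sum_sFib β π).le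
  obtain ⟨hlo, hhi⟩ := cFac_false_mem_of_odd hε hε' hsodd
  calc |cFac ε false (sFib β π x₀)| * ∏ x ∈ (β.image π).erase x₀, |cFac ε false (sFib β π x)|
      ≤ (sFib β π x₀ * ε) * 1 := by
        refine mul_le_mul ?_ ?_ (prod_nonneg fun _ _ => abs_nonneg _) (by positivity)
        · rw [abs_of_nonpos hhi]; linarith
        · exact prod_le_one (fun _ _ => abs_nonneg _) fun _ _ => abs_cFac_le_one hε hε' _ _
    _ ≤ β.card * ε := by rw [mul_one]; exact mul_le_mul_of_nonneg_right hs hε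

omit [Fintype ι] in
/-- **Håstad 2001, Lemma 6.8** (summed form): for a folded `B` (only odd `|β|` carry weight) and
`0 ≤ ε ≤ 1/2`, `|∑_{|β| ≤ δ ε⁻¹} b̂(β)² p(∅, β)| ≤ δ`, using `∑_β b̂(β)² ≤ 1`.  Stated for the family of
`β` with `|β| ε ≤ δ`. [cite: Hastad2001, Lemma 6.8] -/
theorem abs_sum_small_le {ε δ : ℝ} (hε : 0 ≤ ε) (hε' : ε ≤ 1 / 2) (hδ : 0 ≤ δ) (π : κ → ι)
    {B : (κ → Bool) → Bool} (hB : IsFolded B) :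
    |∑ β ∈ univ.filter (fun β : Finset κ => (β.card : ℝ) * ε ≤ δ),
        coeff (fun g => sgn (B g)) β ^ 2 * termProd ε π ∅ β| ≤ δ := by
  set b : (κ → Bool) → ℝ := fun g => sgn (B g) with hb
  set F := univ.filter (fun β : Finset κ => (β.card : ℝ) * ε ≤ δ) with hF
  have hterm : ∀ β ∈ F, |coeff b β ^ 2 * termProd ε π ∅ β| ≤ coeff b β ^ 2 * δ := by
    intro β hβ
    rw [hF, mem_filter] at hβ
    rw [abs_mul, abs_of_nonneg (sq_nonneg _)]
    rcases Nat.even_or_odd β.card with hev | hodd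
    · rw [coeff_eq_zero_of_isOdd hB.isOdd_sgn hev]
      simp
    · exact mul_le_mul_of_nonneg_left
        ((abs_termProd_empty_le_card_mul hε hε' π hodd).trans hβ.2) (sq_nonneg _)
  have hpars : ∑ β ∈ F, coeff b β ^ 2 ≤ 1 :=
    sum_coeff_sq_le_one b (fun g => by rw [hb, sq, sgn_mul_self]) F
  calc |∑ β ∈ F, coeff b β ^ 2 * termProd ε π ∅ β|
      ≤ ∑ β ∈ F, |coeff b β ^ 2 * termProd ε π ∅ β| := abs_sum_le_sum_abs _ _
    _ ≤ ∑ β ∈ F, coeff b β ^ 2 * δ := sum_le_sum hterm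
    _ = (∑ β ∈ F, coeff b β ^ 2) * δ := by rw [sum_mul]
    _ ≤ 1 * δ := mul_le_mul_of_nonneg_right hpars hδ
    _ = δ := one_mul δ

/-! ### Injective projections -/

omit [Fintype ι] [Fintype κ] [DecidableEq κ] in
/-- If `π` is injective on `β`, every fibre over `π(β)` is a singleton: `s_x = 1`. [folklore] -/
theorem sFib_eq_one_of_injOn {β : Finset κ} {π : κ → ι} (hinj : Set.InjOn π β) {x : ι}
    (hx : x ∈ β.image π) : sFib β π x = 1 := by
  obtain ⟨y, hy, rfl⟩ := mem_image.1 hx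
  unfold sFib
  rw [card_eq_one]
  refine ⟨y, ?_⟩
  ext z
  simp only [mem_filter, mem_singleton]
  constructor
  · rintro ⟨hz, hπ⟩
    exact hinj hz hy hπ
  · rintro rfl
    exact ⟨hy, rfl⟩

omit [Fintype ι] [Fintype κ] [DecidableEq κ] in
/-- `c⁺(1) = -ε`, so for `π` injective on `β`: `p(∅, β) = (-ε)^{|β|}` — the case of smooth projections,
in which `E[χ_β(m)]` is a product of `|β|` independent factors `E[sgn m_y] = ½(-1) + ½(1 - 2ε)`.
[cite: Hastad2001, §6.1 (eq. (36) with all s_x = 1)] -/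
theorem termProd_empty_of_injOn (ε : ℝ) {β : Finset κ} {π : κ → ι} (hinj : Set.InjOn π β) :
    termProd ε π ∅ β = (-ε) ^ β.card := by
  unfold termProd
  rw [← card_image_of_injOn hinj, ← prod_const]
  refine prod_congr rfl fun x hx => ?_
  rw [sFib_eq_one_of_injOn hinj hx]
  simp only [notMem_empty, decide_false, cFac, Bool.false_eq_true, if_false, pow_one]
  ring

omit [Fintype ι] [Fintype κ] [DecidableEq κ] in
/-- For `π` injective on `β`, `S^U_ε(β) = |β| · min(1, ε)`. [cite: Hastad2001, §6.1] -/
theorem SU_of_injOn (ε : ℝ) {β : Finset κ} {π : κ → ι} (hinj : Set.InjOn π β) :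
    SU ε β π = β.card * min 1 ε := by
  unfold SU
  rw [← card_image_of_injOn hinj, ← nsmul_eq_mul, ← sum_const]
  refine sum_congr rfl fun x hx => ?_
  rw [sFib_eq_one_of_injOn hinj hx, Nat.cast_one, one_mul]

omit [Fintype ι] [Fintype κ] [DecidableEq κ] in
/-- `S^U` is monotone in `β`: `β' ⊆ β ⇒ S^U_ε(β') ≤ S^U_ε(β)` (for `ε ≥ 0`), since every fibre grows.
[cite: Hastad2001, §6.1] -/
theorem SU_mono {ε : ℝ} (hε : 0 ≤ ε) {β' β : Finset κ} (h : β' ⊆ β) (π : κ → ι) :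
    SU ε β' π ≤ SU ε β π := by
  unfold SU
  have hfib : ∀ x, (sFib β' π x : ℝ) ≤ sFib β π x := fun x => by
    exact_mod_cast card_le_card (filter_subset_filter _ h)
  calc ∑ x ∈ β'.image π, min 1 ((sFib β' π x : ℝ) * ε)
      ≤ ∑ x ∈ β'.image π, min 1 ((sFib β π x : ℝ) * ε) :=
        sum_le_sum fun x _ => min_le_min le_rfl (mul_le_mul_of_nonneg_right (hfib x) hε)
    _ ≤ ∑ x ∈ β.image π, min 1 ((sFib β π x : ℝ) * ε) :=
        sum_le_sum_of_subset_of_nonneg (image_subset_image h) fun x _ _ =>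
          le_min zero_le_one (by positivity)

end Literature.Computability.Complexity.Hastad3Sat

end
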